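import Summits.CriticalPhenomena.CardyFormulaZ2.Theorems.BoundaryDefectGaussianR.Negative.MarkDensityPartition

/-!
# Negative lemmas for the crux `CardyBoundaryCoulombGas.BoundaryDefectGaussianR`, II —
# the constant of the mark-density member is capped at Cardy's (`C ≤ cardyConst/3`)

Sequel of `MarkDensityPartition.lean` (refuter, cdisprove seat, cycle 2; everything proved, no
`sorry`, no proposition defined, no named fact). With the exact partition identity and the Fatou
bound of part I:

* `hasDerivAt_cardy_etaFun` — `(cardyConst/3) · Δ^{1/3}((x-a)(x-b)(x-c))^{-2/3} = ∂ₓ F(η(a,b,c,x))`,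
  `η` = Cardy's cross-ratio (`crossRatio_eq_etaFun`), `F = cardyFunction` (chain rule on the tree's
  `hasDerivAt_cardyFunction_holds`; the algebra of route support `PureProductIntegrates`, stmt-5664);
  `integral_shape_eq` (FTC on `[c', X]`), `integral_shape_le_one` (real form of the Fatou cap).
* **`markDensity_constant_le`** — EVERY pointwise limit `C · shape` of the member-(i) mark density
  on `ℤ × ℕ` has `C ≤ cardyConst/3` (`F(0) = 0` as `c' → c⁺`; `F(1) = 1` along the family
  `a = 0, b = 1-t, c = 1, X = 2`, `t → 0⁺`); `not_markDensityLaw_of_gt` — the member-(i) law with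
  any constant `C > cardyConst/3` is false; `markDensityLaw_iff_shape_form` — stmt-5661 asserts
  exactly the extremal constant.

Moral for provers/planners: stmt-5661 = "shape law + no mass lost at the lattice scale, at the
marks, or at infinity"; the tightness in the route's DensityIntegration step is the whole
difference between the shape statement and Cardy's formula, and member (i) can only fail from
BELOW in the constant.
-/

noncomputable section

open Filter Topology Set MeasureTheory
open scoped BigOperators ENNReal

namespace Summit.CriticalPhenomena.CardyFormulaZ2.Theorems.BoundaryDefectGaussianR.Negative

open Literature.Probability.Percolation Literature.Probability.LatticeModels
open Literature.Probability.RandomPlanarGeometry (cardyConst cardyConst_pos crossRatio)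

/-! #### Step C: from the `lintegral` cap to a cap on the real integral over `[c', X]` -/

/-- The claimed shape is positive on admissible configurations. [folklore] -/
theorem shapeFun_pos {a b c x : ℝ} (hab : a < b) (hbc : b < c) (hcx : c < x) : 0 < shapeFun a b c x := by
  unfold shapeFun
  have h1 : 0 < (b - a) * (c - b) * (c - a) := by
    have := sub_pos.2 hab; have := sub_pos.2 hbc; have := sub_pos.2 (hab.trans hbc); positivity
  have h2 : 0 < (x - a) * (x - b) * (x - c) := by
    have := sub_pos.2 (hab.trans (hbc.trans hcx)); have := sub_pos.2 (hbc.trans hcx)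
    have := sub_pos.2 hcx; positivity
  exact mul_pos (Real.rpow_pos_of_pos h1 _) (Real.rpow_pos_of_pos h2 _)

/-- The claimed shape is continuous off the marks. [folklore] -/
theorem continuousAt_shapeFun {a b c x : ℝ} (hab : a < b) (hbc : b < c) (hcx : c < x) :
    ContinuousAt (fun y => shapeFun a b c y) x := by
  unfold shapeFun
  have h2 : (x - a) * (x - b) * (x - c) ≠ 0 := by
    have := sub_pos.2 (hab.trans (hbc.trans hcx)); have := sub_pos.2 (hbc.trans hcx)
    have := sub_pos.2 hcx; positivity
  refine continuousAt_const.mul ?_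
  exact ContinuousAt.rpow_const (by fun_prop) (Or.inl h2)

/-- Continuity on `[c', X]`, `c < c'`. [folklore] -/
theorem continuousOn_shapeFun {a b c c' X : ℝ} (hab : a < b) (hbc : b < c) (hcc' : c < c') :
    ContinuousOn (fun y => shapeFun a b c y) (Set.Icc c' X) :=
  fun _ hx => (continuousAt_shapeFun hab hbc (hcc'.trans_le hx.1)).continuousWithinAt

/-- **Fatou cap (real form).** If member (i) holds with constant `C > 0` then
`C · ∫_{c'}^{X} shape ≤ 1` for all `a < b < c < c' ≤ X`. [folklore] -/
theorem integral_shape_le_one {C : ℝ} (hC : 0 < C)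
    (h : ∀ a b c x : ℝ, a < b → b < c → c < x →
      Tendsto (markDensitySeq a b c x) atTop (𝓝 (C * shapeFun a b c x)))
    {a b c c' X : ℝ} (hab : a < b) (hbc : b < c) (hcc' : c < c') (hc'X : c' ≤ X) :
    C * ∫ x in c'..X, shapeFun a b c x ≤ 1 := by
  have hcont : ContinuousOn (fun x => C * shapeFun a b c x) (Set.Icc c' X) :=
    continuousOn_const.mul (continuousOn_shapeFun hab hbc hcc')
  have hint : IntegrableOn (fun x => C * shapeFun a b c x) (Set.Ioc c' X) :=
    (hcont.integrableOn_compact isCompact_Icc).mono_set Set.Ioc_subset_Icc_self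
  have hnn : 0 ≤ᵐ[volume.restrict (Set.Ioc c' X)] fun x => C * shapeFun a b c x := by
    refine ae_restrict_of_forall_mem measurableSet_Ioc fun x hx => ?_
    exact (mul_pos hC (shapeFun_pos hab hbc (hcc'.trans hx.1))).le
  have key := lintegral_shape_le_one h hab hbc hcc' (X := X)
  rw [← ofReal_integral_eq_lintegral_ofReal hint hnn] at key
  have key' : ∫ x in Set.Ioc c' X, C * shapeFun a b c x ≤ 1 := by
    have := (ENNReal.ofReal_le_ofReal_iff zero_le_one).1 (by simpa using key)
    exact this
  rwa [← intervalIntegral.integral_of_le hc'X, intervalIntegral.integral_const_mul] at key'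

/-! #### Step D: the claimed shape is an exact derivative — `(cardyConst/3)·shape = d/dx F(η(a,b,c,x))` -/

/-- Cardy's cross-ratio of `(a, b, c, x)` as a rational function of the moving point `x`. [folklore] -/
def etaFun (a b c x : ℝ) : ℝ := (b - a) * (x - c) / ((c - a) * (x - b))

/-- `etaFun` IS the tree's `crossRatio ![a,b,c,x]`. [folklore] -/
theorem crossRatio_eq_etaFun (a b c x : ℝ) : crossRatio ![a, b, c, x] = etaFun a b c x := by
  unfold crossRatio etaFun
  simp only [Matrix.cons_val_zero, Matrix.cons_val_one, Matrix.cons_val_two, Matrix.cons_val_three,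
    Matrix.head_cons, Matrix.tail_cons]
  have h1 : (a - b) * (c - x) = (b - a) * (x - c) := by ring
  have h2 : (a - c) * (b - x) = (c - a) * (x - b) := by ring
  rw [h1, h2]

/-- `η(a,b,c,c) = 0`. [folklore] -/
theorem etaFun_self (a b c : ℝ) : etaFun a b c c = 0 := by simp [etaFun]

/-- `0 < η` for `a < b < c < x`. [folklore] -/
theorem etaFun_pos {a b c x : ℝ} (hab : a < b) (hbc : b < c) (hcx : c < x) : 0 < etaFun a b c x := by
  unfold etaFun
  have := sub_pos.2 hab; have := sub_pos.2 hcx; have := sub_pos.2 (hab.trans hbc)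
  have := sub_pos.2 (hbc.trans hcx)
  positivity

/-- `1 - η = (c-b)(x-a)/((c-a)(x-b))`. [folklore] -/
theorem one_sub_etaFun {a b c x : ℝ} (hca : c ≠ a) (hxb : x ≠ b) :
    1 - etaFun a b c x = (c - b) * (x - a) / ((c - a) * (x - b)) := by
  unfold etaFun
  have h1 : c - a ≠ 0 := sub_ne_zero.2 hca
  have h2 : x - b ≠ 0 := sub_ne_zero.2 hxb
  field_simp
  ring

/-- `η < 1` for `a < b < c < x`. [folklore] -/
theorem etaFun_lt_one {a b c x : ℝ} (hab : a < b) (hbc : b < c) (hcx : c < x) : etaFun a b c x < 1 := by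
  have h := one_sub_etaFun (a := a) (b := b) (c := c) (x := x) (hab.trans hbc).ne' (hbc.trans hcx).ne'
  have : 0 < (c - b) * (x - a) / ((c - a) * (x - b)) := by
    have := sub_pos.2 hbc; have := sub_pos.2 (hab.trans (hbc.trans hcx))
    have := sub_pos.2 (hab.trans hbc); have := sub_pos.2 (hbc.trans hcx)
    positivity
  linarith

/-- `∂ₓη = (b-a)(c-b)/((c-a)(x-b)²)`. [folklore] -/
theorem hasDerivAt_etaFun {a b c x : ℝ} (hca : c ≠ a) (hxb : x ≠ b) :
    HasDerivAt (fun x => etaFun a b c x) ((b - a) * (c - b) / ((c - a) * (x - b) ^ 2)) x := by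
  unfold etaFun
  have h1 : c - a ≠ 0 := sub_ne_zero.2 hca
  have h2 : x - b ≠ 0 := sub_ne_zero.2 hxb
  have hN : HasDerivAt (fun x : ℝ => (b - a) * (x - c)) (b - a) x := by
    simpa using ((hasDerivAt_id x).sub_const c).const_mul (b - a)
  have hD : HasDerivAt (fun x : ℝ => (c - a) * (x - b)) (c - a) x := by
    simpa using ((hasDerivAt_id x).sub_const b).const_mul (c - a)
  refine (hN.div hD (mul_ne_zero h1 h2)).congr_deriv ?_
  rw [div_eq_div_iff (pow_ne_zero 2 (mul_ne_zero h1 h2)) (mul_ne_zero h1 (pow_ne_zero 2 h2))]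
  ring

/-- The algebra of the chain rule: `F'(η) · η' = (cardyConst/3) · shape` — the identity behind
`PureProductIntegrates` (stmt-5664) and behind `HalfPlaneMarkDensityLaw = F'(η)∂ₓη`. [folklore] -/
theorem cardyDeriv_mul_etaDeriv {a b c x : ℝ} (hab : a < b) (hbc : b < c) (hcx : c < x) :
    cardyConst / 3 * (etaFun a b c x * (1 - etaFun a b c x)) ^ (-(2 / 3 : ℝ))
        * ((b - a) * (c - b) / ((c - a) * (x - b) ^ 2))
      = cardyConst / 3 * shapeFun a b c x := by
  have hP : 0 < b - a := sub_pos.2 hab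
  have hQ : 0 < c - b := sub_pos.2 hbc
  have hR : 0 < c - a := sub_pos.2 (hab.trans hbc)
  have hU : 0 < x - a := sub_pos.2 (hab.trans (hbc.trans hcx))
  have hV : 0 < x - b := sub_pos.2 (hbc.trans hcx)
  have hW : 0 < x - c := sub_pos.2 hcx
  have h1 : c - a ≠ 0 := hR.ne'
  have h2 : x - b ≠ 0 := hV.ne'
  have hM : etaFun a b c x * (1 - etaFun a b c x)
      = ((b - a) * (c - b) * (x - a) * (x - c)) / ((c - a) * (x - b)) ^ 2 := by
    rw [one_sub_etaFun (hab.trans hbc).ne' (hbc.trans hcx).ne']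
    unfold etaFun
    rw [div_mul_div_comm, ← pow_two]
    congr 1
    ring
  rw [hM, mul_assoc]
  congr 1
  -- compare logarithms of two positive reals
  have hMpos : 0 < ((b - a) * (c - b) * (x - a) * (x - c)) / ((c - a) * (x - b)) ^ 2 := by positivity
  have hDpos : 0 < (b - a) * (c - b) / ((c - a) * (x - b) ^ 2) := by positivity
  have hL : 0 < (((b - a) * (c - b) * (x - a) * (x - c)) / ((c - a) * (x - b)) ^ 2) ^ (-(2 / 3 : ℝ))
      * ((b - a) * (c - b) / ((c - a) * (x - b) ^ 2)) :=
    mul_pos (Real.rpow_pos_of_pos hMpos _) hDpos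
  have hS : 0 < shapeFun a b c x := shapeFun_pos hab hbc hcx
  refine Real.log_injOn_pos (Set.mem_Ioi.2 hL) (Set.mem_Ioi.2 hS) ?_
  have e1 : Real.log ((((b - a) * (c - b) * (x - a) * (x - c)) / ((c - a) * (x - b)) ^ 2) ^ (-(2 / 3 : ℝ))
        * ((b - a) * (c - b) / ((c - a) * (x - b) ^ 2)))
      = -(2 / 3) * (Real.log (b - a) + Real.log (c - b) + Real.log (x - a) + Real.log (x - c)
          - 2 * (Real.log (c - a) + Real.log (x - b)))
        + (Real.log (b - a) + Real.log (c - b) - (Real.log (c - a) + 2 * Real.log (x - b))) := by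
    rw [Real.log_mul (Real.rpow_pos_of_pos hMpos _).ne' hDpos.ne', Real.log_rpow hMpos,
      Real.log_div (by positivity) (by positivity), Real.log_pow,
      Real.log_mul (by positivity) hW.ne', Real.log_mul (by positivity) hU.ne',
      Real.log_mul hP.ne' hQ.ne', Real.log_mul hR.ne' hV.ne',
      Real.log_div (by positivity) (by positivity), Real.log_mul hP.ne' hQ.ne',
      Real.log_mul hR.ne' (by positivity), Real.log_pow]
    push_cast
    ring
  have e2 : Real.log (shapeFun a b c x)
      = (1 / 3) * (Real.log (b - a) + Real.log (c - b) + Real.log (c - a))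
        - (2 / 3) * (Real.log (x - a) + Real.log (x - b) + Real.log (x - c)) := by
    unfold shapeFun
    rw [Real.log_mul (Real.rpow_pos_of_pos (by positivity) _).ne' (Real.rpow_pos_of_pos (by positivity) _).ne',
      Real.log_rpow (by positivity), Real.log_rpow (by positivity),
      Real.log_mul (by positivity) hR.ne', Real.log_mul hP.ne' hQ.ne',
      Real.log_mul (by positivity) hW.ne', Real.log_mul hU.ne' hV.ne']
    ring
  rw [e1, e2]
  ring

/-- **Member (i)'s shape is an exact derivative**: for `a < b < c < x`,
`d/dx F(η(a,b,c,x)) = (cardyConst/3) · Δ^{1/3} ((x-a)(x-b)(x-c))^{-2/3}` (chain rule with the tree's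
`hasDerivAt_cardyFunction_holds`). [folklore] -/
theorem hasDerivAt_cardy_etaFun {a b c x : ℝ} (hab : a < b) (hbc : b < c) (hcx : c < x) :
    HasDerivAt (fun x => Literature.Probability.RandomPlanarGeometry.cardyFunction (etaFun a b c x)) (cardyConst / 3 * shapeFun a b c x) x := by
  have hη : etaFun a b c x ∈ Set.Ioo (0 : ℝ) 1 := ⟨etaFun_pos hab hbc hcx, etaFun_lt_one hab hbc hcx⟩
  have hF : HasDerivAt Literature.Probability.RandomPlanarGeometry.cardyFunction
      (cardyConst / 3 * (etaFun a b c x * (1 - etaFun a b c x)) ^ (-(2 / 3 : ℝ))) (etaFun a b c x) :=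
    Literature.Probability.RandomPlanarGeometry.hasDerivAt_cardyFunction_holds hη
  have hE := hasDerivAt_etaFun (a := a) (b := b) (hab.trans hbc).ne' (hbc.trans hcx).ne' (c := c) (x := x)
  have h := hF.comp x hE
  rw [cardyDeriv_mul_etaDeriv hab hbc hcx] at h
  exact h

/-- FTC: `∫_{c'}^{X} shape = (3/cardyConst) · (F(η(X)) - F(η(c')))` for `c < c' ≤ X`. [folklore] -/
theorem integral_shape_eq {a b c c' X : ℝ} (hab : a < b) (hbc : b < c) (hcc' : c < c') (hc'X : c' ≤ X) :
    ∫ x in c'..X, shapeFun a b c x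
      = 3 / cardyConst * (Literature.Probability.RandomPlanarGeometry.cardyFunction (etaFun a b c X) - Literature.Probability.RandomPlanarGeometry.cardyFunction (etaFun a b c c')) := by
  have hderiv : ∀ x ∈ Set.uIcc c' X,
      HasDerivAt (fun x => Literature.Probability.RandomPlanarGeometry.cardyFunction (etaFun a b c x)) (cardyConst / 3 * shapeFun a b c x) x := by
    intro x hx
    rw [Set.uIcc_of_le hc'X] at hx
    exact hasDerivAt_cardy_etaFun hab hbc (hcc'.trans_le hx.1)
  have hcont : ContinuousOn (fun x => cardyConst / 3 * shapeFun a b c x) (Set.uIcc c' X) := by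
    rw [Set.uIcc_of_le hc'X]
    exact continuousOn_const.mul (continuousOn_shapeFun hab hbc hcc')
  have h := intervalIntegral.integral_eq_sub_of_hasDerivAt hderiv hcont.intervalIntegrable
  rw [intervalIntegral.integral_const_mul] at h
  have hc : cardyConst ≠ 0 := cardyConst_pos.ne'
  field_simp
  field_simp at h
  linarith

/-! #### Step E: limits `c' → c⁺` (F(0) = 0) and `η → 1⁻` (F(1) = 1): the cap `C ≤ cardyConst/3` -/

/-- Continuity of `η` in the moving point. [folklore] -/
theorem continuousAt_etaFun {a b c x : ℝ} (hca : c ≠ a) (hxb : x ≠ b) :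
    ContinuousAt (fun y => etaFun a b c y) x :=
  (hasDerivAt_etaFun hca hxb).continuousAt

/-- `F(η(a,b,c,c')) → 0` as `c' → c⁺`. [folklore] -/
theorem tendsto_cardy_etaFun_right {a b c : ℝ} (hab : a < b) (hbc : b < c) :
    Tendsto (fun c' => Literature.Probability.RandomPlanarGeometry.cardyFunction (etaFun a b c c')) (𝓝[>] c) (𝓝 0) := by
  have hη : Tendsto (fun c' => etaFun a b c c') (𝓝[>] c) (𝓝[Set.Icc 0 1] 0) := by
    refine tendsto_nhdsWithin_iff.2 ⟨?_, ?_⟩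
    · have h := (continuousAt_etaFun (a := a) (b := b) (hab.trans hbc).ne' hbc.ne' (c := c)).tendsto
      rw [etaFun_self] at h
      exact tendsto_nhdsWithin_of_tendsto_nhds h
    · filter_upwards [self_mem_nhdsWithin] with c' hc'
      exact ⟨(etaFun_pos hab hbc hc').le, (etaFun_lt_one hab hbc hc').le⟩
  have hF : ContinuousWithinAt Literature.Probability.RandomPlanarGeometry.cardyFunction (Set.Icc 0 1) 0 :=
    Literature.Probability.RandomPlanarGeometry.continuousOn_cardyFunction_holds 0 ⟨le_rfl, zero_le_one⟩
  have h := hF.tendsto.comp hη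
  rwa [Literature.Probability.RandomPlanarGeometry.cardyFunction_zero] at h

/-- **Cap at a fixed configuration**: `C · (3/cardyConst) · F(η(a,b,c,X)) ≤ 1`. [folklore] -/
theorem cap_config {C : ℝ} (hC : 0 < C)
    (h : ∀ a b c x : ℝ, a < b → b < c → c < x →
      Tendsto (markDensitySeq a b c x) atTop (𝓝 (C * shapeFun a b c x)))
    {a b c X : ℝ} (hab : a < b) (hbc : b < c) (hcX : c < X) :
    C * (3 / cardyConst) * Literature.Probability.RandomPlanarGeometry.cardyFunction (etaFun a b c X) ≤ 1 := by
  have hev : ∀ᶠ c' in 𝓝[>] c,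
      C * (3 / cardyConst) * (Literature.Probability.RandomPlanarGeometry.cardyFunction (etaFun a b c X) - Literature.Probability.RandomPlanarGeometry.cardyFunction (etaFun a b c c')) ≤ 1 := by
    filter_upwards [Ioo_mem_nhdsGT hcX] with c' hc'
    have h1 := integral_shape_le_one hC h hab hbc hc'.1 hc'.2.le
    rw [integral_shape_eq hab hbc hc'.1 hc'.2.le] at h1
    linarith
  have hlim : Tendsto (fun c' => C * (3 / cardyConst) * (Literature.Probability.RandomPlanarGeometry.cardyFunction (etaFun a b c X) - Literature.Probability.RandomPlanarGeometry.cardyFunction (etaFun a b c c')))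
      (𝓝[>] c) (𝓝 (C * (3 / cardyConst) * (Literature.Probability.RandomPlanarGeometry.cardyFunction (etaFun a b c X) - 0))) :=
    ((tendsto_cardy_etaFun_right hab hbc).const_sub _).const_mul _
  have := le_of_tendsto hlim hev
  simpa using this

/-- The test family: `a = 0, b = 1 - t, c = 1, X = 2` has cross-ratio `(1-t)/(1+t) → 1`. [folklore] -/
theorem etaFun_family (t : ℝ) : etaFun 0 (1 - t) 1 2 = (1 - t) / (1 + t) := by
  unfold etaFun
  congr 1 <;> ring

/-- **THE CAP (unconditional).** Any pointwise limit of member (i) of the form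
`n · P(E_⌊xn⌋) → C · Δ^{1/3}((x-a)(x-b)(x-c))^{-2/3}` (all `a < b < c < x`) has `C ≤ cardyConst/3`:
disjointness of the mark events (`Σ_x P(E_x) ≤ 1`) + Fatou + `(cardyConst/3)·shape = ∂ₓF(η)` +
`F(0) = 0`, `F(1) = 1`. So the typed sibling `HalfPlaneMarkDensityLaw` (stmt-5661, `C = cardyConst/3`)
sits exactly AT the cap: it is the shape law PLUS "no mass is lost at the lattice scale or at
infinity" — the tightness the route's DensityIntegration step must supply; and every typing of the
crux's member (i) on `ℤ × ℕ` with a constant `C > cardyConst/3` is refuted outright. [folklore] -/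
theorem markDensity_constant_le {C : ℝ}
    (h : ∀ a b c x : ℝ, a < b → b < c → c < x →
      Tendsto (markDensitySeq a b c x) atTop (𝓝 (C * shapeFun a b c x))) :
    C ≤ cardyConst / 3 := by
  have hcc : 0 < cardyConst := cardyConst_pos
  by_cases hC : 0 < C
  swap
  · have : 0 < cardyConst / 3 := by positivity
    linarith
  -- along the family t → 0⁺
  have hev : ∀ᶠ t in 𝓝[>] (0 : ℝ), C * (3 / cardyConst) * Literature.Probability.RandomPlanarGeometry.cardyFunction ((1 - t) / (1 + t)) ≤ 1 := by
    filter_upwards [Ioo_mem_nhdsGT (zero_lt_one' ℝ)] with t ht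
    have h1 := cap_config hC h (a := 0) (b := 1 - t) (c := 1) (X := 2) (by linarith [ht.2])
      (by linarith [ht.1]) (by norm_num)
    rwa [etaFun_family] at h1
  have hη : Tendsto (fun t : ℝ => (1 - t) / (1 + t)) (𝓝[>] 0) (𝓝[Set.Icc 0 1] 1) := by
    refine tendsto_nhdsWithin_iff.2 ⟨?_, ?_⟩
    · have : Tendsto (fun t : ℝ => (1 - t) / (1 + t)) (𝓝 0) (𝓝 ((1 - 0) / (1 + 0))) :=
        ((continuous_const.sub continuous_id).continuousAt.tendsto).div
          ((continuous_const.add continuous_id).continuousAt.tendsto) (by norm_num)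
      rw [sub_zero, add_zero, div_one] at this
      exact tendsto_nhdsWithin_of_tendsto_nhds this
    · filter_upwards [Ioo_mem_nhdsGT (zero_lt_one' ℝ)] with t ht
      have h1 : 0 < 1 + t := by linarith [ht.1]
      constructor
      · exact div_nonneg (by linarith [ht.2]) h1.le
      · rw [div_le_one h1]; linarith [ht.1]
  have hF : ContinuousWithinAt Literature.Probability.RandomPlanarGeometry.cardyFunction (Set.Icc 0 1) 1 :=
    Literature.Probability.RandomPlanarGeometry.continuousOn_cardyFunction_holds 1 ⟨zero_le_one, le_rfl⟩
  have hF1 : Literature.Probability.RandomPlanarGeometry.cardyFunction 1 = 1 := Literature.Probability.RandomPlanarGeometry.cardyFunction_one_holds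
  have hlim : Tendsto (fun t : ℝ => C * (3 / cardyConst) * Literature.Probability.RandomPlanarGeometry.cardyFunction ((1 - t) / (1 + t))) (𝓝[>] 0)
      (𝓝 (C * (3 / cardyConst) * Literature.Probability.RandomPlanarGeometry.cardyFunction 1)) :=
    (hF.tendsto.comp hη).const_mul _
  have hle := le_of_tendsto hlim hev
  rw [hF1, mul_one] at hle
  have : C * 3 ≤ cardyConst := by
    rw [mul_div_assoc'] at hle
    rwa [div_le_one hcc] at hle
  linarith

/-- Corollary: **refuted strengthening** — member (i) on `ℤ × ℕ` with any constant above Cardy's. [folklore] -/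
theorem not_markDensityLaw_of_gt {C : ℝ} (hC : cardyConst / 3 < C) :
    ¬ ∀ a b c x : ℝ, a < b → b < c → c < x →
      Tendsto (markDensitySeq a b c x) atTop (𝓝 (C * shapeFun a b c x)) :=
  fun h => absurd (markDensity_constant_le h) (not_le.2 hC)

/-- The typed sibling `HalfPlaneMarkDensityLaw` (stmt-5661) is the EXTREMAL instance
`C = cardyConst/3` of `markDensity_constant_le` (its hypothesis with `C := cardyConst/3`, up to
reassociation). Stated as: the law implies the cap's hypothesis. [folklore] -/
theorem markDensityLaw_iff_shape_form :
    Summit.CriticalPhenomena.CardyFormulaZ2.Theses.CardyBoundaryCoulombGas.HalfPlaneMarkDensityLaw →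
      ∀ a b c x : ℝ, a < b → b < c → c < x →
        Tendsto (markDensitySeq a b c x) atTop (𝓝 (cardyConst / 3 * shapeFun a b c x)) := by
  intro h a b c x hab hbc hcx
  have h1 := h a b c x hab hbc hcx
  have e : cardyConst / 3 * shapeFun a b c x
      = cardyConst / 3 * ((b - a) * (c - b) * (c - a)) ^ (1 / 3 : ℝ)
          * ((x - a) * (x - b) * (x - c)) ^ (-(2 / 3) : ℝ) := by
    unfold shapeFun; ring
  rw [e]
  exact h1

end Summit.CriticalPhenomena.CardyFormulaZ2.Theorems.BoundaryDefectGaussianR.Negative
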